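import Literature.MathematicalPhysics.QuantumFieldTheory.Balaban1983to89.B8SockH59NotAtCube
import Literature.MathematicalPhysics.QuantumFieldTheory.Balaban1983to89.B8LeafSocketsB9
import Summits.QuantumFields.YangMills.Theorems.UnitScaleTiltHalvingHSockets1OfLeafSockets
import HarnessLib

/-!
# Route `UnitScaleTilt`, crux K1 child «MinimiserStabilityRegPr» (stmt-QuantumFields-19200), registered stub `stub_halvingStep` (v10 `BirthV10`) —
# ★★ NEGATIVE CERTIFICATE (located, N1 «SB9-SUPPLY LOCATE»): THE v6 LEAF SOCKET `SB9AllL` IS FALSE AT EVERY CUBE MEMBER `cubeFam false …`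
# (finite `Ω₀`, the `SideTouches` currency) — by the tree's own corner-defect certificates of cell `pub-ymgap` (dag-n05-e, 2026-08-27)

Cell `ym3-torus` (HUMAN RULING D-0037: YM₃ on T³ is ladder rung R3 — NOT d = 4, NOT a mass gap, NOT the Clay problem), width seat `ym-ust-19200-w7` gen 6
(row «(N1) SB9-SUPPLY LOCATE», LEAD-H ★w5-19200 g6 23:06:38Z).  `--supports stmt-QuantumFields-19200 --as helper`; THEOREMS ONLY (0 `def`, 0 `sorry`);
count-neutral; NOTHING of the stub, the crux, [4] or [Balaban1985RegularSpaces] is refuted here — only a TYPING of the H lane's display.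

WHAT (by name, generic C⋆-algebra `𝔸`, any `d ≥ 2`):
* ★ `sockH59_of_allLevels_len` — lit ✓`B8LeafSocketsB9.sockH59_of_allLevels` with the Hölder length ∃-bound INSIDE `∀ m` (LEAD-H WORD 10 SHAPE
  RULING «`∃ len` inside `∀ m`»): `(∀ m ≤ k, ∃ len, SockB9P3 L B₀ B₀β cP β len η m Ω Λs Λb) → SockH59 L B₀ B₀′ (min cP (cP∕K₀)) η k Ω Λs Λb` — same 30-line
  proof (lines 1–2 of (1.59) are `len`-free).
* ★★ `not_sockB9All_cubeMember` — for `1 ≤ L ≤ ρ`, `η > 0`, `k ≥ 1`, `B₀ > 0`, `cP > 0` (any `B₀β β`):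
  `¬ (∀ m, m ≤ k → ∃ len, SockB9P3 L B₀ B₀β cP β len η m (cubeFam false L a M ρ k) (cubeLamS L a M ρ k) (cubeLamB L a M ρ k))` —
  EXACTLY the per-member body of v6's `SB9AllL` (★w3-19200 g9 #46 (2), ★w7 BASE-LEAF ✓p676580's `hLeaf`, w2-19936 g9 STEP-LEAF) at the member
  `(L := (F.P K).L, a, M := M′, ρ := ρ′ ≥ L, k := K − n ≥ 1, η := (F.L⁻¹)^{K−n})`.  PROOF: `sockH59_of_allLevels_len` (with `B₀′ := 0`) then lit
  ✓`B8SockH59NotAtCube.not_sockH59_cubeMember` (the exposed corner of `□₀`: the bump gauge `u = e^{iηa}` one diagonal step outside the max corner puts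
  a pure-gauge mode on the two OUTER SIDES of the corner plaquette — counted on (1.59)'s LEFT (`msup` over `SideTouches (Ω j)`), invisible on its
  RIGHT (`|J|₍₋₃₎` over `BondTouches`, `|B₁|` over the interior constraint bonds, Landau at `Ω₀`-sites); lit ✓`B8SockH59CornerDefect.h59_body_false_of_corner`).
CONSEQUENCE (for LEAD-H ∕ ★★OWNER, located — NOT a claim about print): `hLeaf = signs ∧ SLetτAllL ∧ SB9AllL` (six signs incl. `0 < B₀`, `0 < cB9`)
is UNINHABITABLE as soon as one member exists; so K-final v3 ∕ BOARD v6 «H = SLetτAllL ∧ SB9AllL» would display a REFUTABLE conjunct.  The same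
located defect («(1.59) socket in the `SideTouches` currency at a FINITE `Ω₀`», pub-ymgap ✓`B8Ineq159FlatCornerDefect` ✓`B8SockH59CornerDefect`
✓`B8SockH59NotAtCube` ✓`B8JunctionH59Vacuity`) bears on v4–v5.1's `SB9L` (single level `K − n − 1 ≥ 1`) and on `H59TL`∕`H59rawL` (H59-bodies at
`U′ := pull (U^{gJ})♯ 0`, refutable at the trivial member `U = 1`, `gJ = 1` by ✓`h59_body_false_of_corner`; typing that instance is a separate, larger
file).  REPAIRS OF RECORD (pub-ymgap, owners' choice there): (R-a) the `…Bdry` currency — LHS over `BondTouches (Ω j)` (print's «bonds with an end-point in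
Ω_j», [B8] p.77) + the collar term `Bbd·Φ₀(A′)` (lit ✓`B8LeafModelZd3Bdry`, ✓`B9SupplySockB9P3ZdLettersOmega` §3, supplied by ✓`B9SupplySockB9P3ZdAt.sockB9P3D4_at'`);
(R-b) the member family with `Ω₀ = T` (`cubeFam true`, print's `(T, □₁, …, □_k)` of Prop. 6 p.99), where plain `SockB9P3` is supplied (✓`sockB9P3_at_univ'`).
Print is consistent (its (1.59) norms are suprema over bonds OF `Ω_j`, and Prop. 6's family has `Ω₀ = T`); the defect is the tree's `SideTouches` reading at a
finite `Ω₀`.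

References: T. Bałaban, CMP **99** (1985) 75–102 [Balaban1985RegularSpaces] ((1.58)–(1.59) p.86, Thm 4 p.88, Prop. 6 p.99, (1.131) p.99, p.77);
CMP **99** (1985) 389–434 [Balaban1985BackgroundPropagators] (Thm 3.3 p.399, (3.27) p.395).
-/

set_option autoImplicit false

noncomputable section

open NormedSpace

namespace Summit.QuantumFields.YangMills.Theorems.HalvingHSB9AllNotAtCubeMember

open Literature.MathematicalPhysics.QuantumFieldTheory.Balaban1983to89
open MatrixLog B7Prop1Explicit B7Prop2Explicit B7Prop1Local B7Eq92Concrete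
open B8Ineq132 (covDerivFwd InAk)
open B8Eq119TwistedAxial (Restr129 InAx)
open B8Eq184Proof (cfgExp)
open B8Lemma1NonAbelian (mulCfg)
open B8Eq140Level (SideTouches)
open B8Eq138LandauZd (IsLandau138W)
open B8Prop3GaugeFixedKLevel (mem_unitaryUnits_of_mgauge_eq mulCfg_eq_gaugeAct_of_mgauge_eq)
open B8LeafModelZd (SockH59)
open B8LeafModelZd3 (SockB9P3)
open B8Eq131CubesAdmissible (cubeFam)
open B8CubeMemberZd (cubeLamS cubeLamB)
open B8SockH59NotAtCube (not_sockH59_cubeMember)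

variable {d : ℕ} {𝔸 : Type*} [CStarAlgebra 𝔸] [Nontrivial 𝔸]

/-- ★ lit ✓`B8LeafSocketsB9.sockH59_of_allLevels` with the Hölder length `len` ∃-bound INSIDE `∀ m` (the v6 shape): the all-levels b9 socket family
implies Theorem 4's socket `SockH59` below `min cP (cP∕K₀)`; lines 1–2 of (1.59) do not read `len`. [cite: Balaban1985RegularSpaces, (1.57)–(1.59) p.86, Thm 4 p.88; Balaban1985BackgroundPropagators, Thm 3.3 p.399] -/
theorem sockH59_of_allLevels_len (hd : 1 ≤ d) {L : ℕ} (hL : 1 ≤ L) {B₀ B₀' B₀β cP β : ℝ} (hB₀ : 0 < B₀) (hB₀' : 0 ≤ B₀') (hcP : 0 < cP)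
    {η : ℝ} {k : ℕ} {Ω : ℕ → Set (Site d)} {Λs : ℕ → ℕ → Set (Site d)} {Λb : ℕ → ℕ → Set (Site d × Fin d)}
    (H : ∀ m, m ≤ k → ∃ len : Site d → ℝ, SockB9P3 (𝔸 := 𝔸) L B₀ B₀β cP β len η m Ω Λs Λb) :
    SockH59 (𝔸 := 𝔸) L B₀ B₀' (min cP (cP / (2 * (L * (5 * (d : ℝ) * L * B₀)) + 8 * (8 * B₀' * (5 * (d : ℝ) * L * B₀)))))
      η k Ω Λs Λb := by
  set K₀ : ℝ := 2 * (L * (5 * (d : ℝ) * L * B₀)) + 8 * (8 * B₀' * (5 * (d : ℝ) * L * B₀)) with hK₀_def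
  have hL' : (1 : ℝ) ≤ L := by exact_mod_cast hL
  have hd' : (1 : ℝ) ≤ d := by exact_mod_cast hd
  have hK₀ : 0 < K₀ := by
    have h1 : 0 < 2 * (L * (5 * (d : ℝ) * L * B₀)) := by positivity
    have h2 : 0 ≤ 8 * (8 * B₀' * (5 * (d : ℝ) * L * B₀)) := by positivity
    linarith
  have hK₀ne : K₀ ≠ 0 := hK₀.ne'
  intro α₀ α₁ hα₀ hα₁ hs U₀ U' hU₀ hU' h33 h34 _ _ _ m _ hmk u W A' hu hW _ hLan hsa hWA hA0
  set K : ℝ := 2 * (L * (5 * (d : ℝ) * L * B₀ * (α₀ + α₁))) + 8 * (8 * B₀' * (5 * (d : ℝ) * L * B₀) * (α₀ + α₁)) with hK_def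
  have hKK₀ : K = K₀ * (α₀ + α₁) := by rw [hK_def, hK₀_def]; ring
  have hS0 : 0 < α₀ + α₁ := add_pos hα₀ hα₁
  have hKpos : 0 < K := by rw [hKK₀]; exact mul_pos hK₀ hS0
  have hα₀P : α₀ ≤ cP := by linarith only [hα₁, hs, min_le_left cP (cP / K₀)]
  have hKP : K ≤ cP := by
    have h1 : α₀ + α₁ ≤ cP / K₀ := hs.trans (min_le_right _ _)
    calc K = K₀ * (α₀ + α₁) := hKK₀
      _ ≤ K₀ * (cP / K₀) := mul_le_mul_of_nonneg_left h1 hK₀.le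
      _ = cP := by field_simp
  have hWu : ∀ x κ, W x κ ∈ unitaryUnits 𝔸 := mem_unitaryUnits_of_mgauge_eq hU₀ hU' hu hW
  have h33m : InAk L m η α₀ Ω U₀ := fun j hj => h33 j (hj.trans hmk)
  have h34m : InAk L m η α₀ Ω (mulCfg W U₀) := by
    have h1 : InAk L m η α₀ Ω (mulCfg U' U₀) := fun j hj => h34 j (hj.trans hmk)
    have hui : ∀ x, u⁻¹ x ∈ U1 𝔸 := fun x => unitaryUnits_le_U1 ((unitaryUnits 𝔸).inv_mem (hu x))
    rw [mulCfg_eq_gaugeAct_of_mgauge_eq hW]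
    exact (B8Ineq132.inAk_gaugeAct_iff L m η α₀ Ω hui _).2 h1
  obtain ⟨len, Hm⟩ := H m hmk
  obtain ⟨ha, hg, -, -, -⟩ := Hm α₀ K hα₀ hα₀P hKpos hKP U₀ W hU₀ hWu h33m h34m hLan A' hsa hWA hA0
  exact ⟨ha, hg⟩

/-- ★★ **THE v6 LEAF SOCKET `SB9AllL` IS FALSE AT EVERY CUBE MEMBER `cubeFam false L a M ρ k`** (`d ≥ 2`, `1 ≤ L ≤ ρ`, `η > 0`, `k ≥ 1`, `B₀ > 0`,
`cP > 0`, any `B₀β β`): its per-member body (`∃ len` inside `∀ m`) implies `SockH59` (above), refuted at the exposed corner of `□₀` by lit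
✓`B8SockH59NotAtCube.not_sockH59_cubeMember`. [cite: Balaban1985RegularSpaces, (1.58)–(1.59) p.86, Thm 4 p.88, (1.131) p.99, p.77; Balaban1985BackgroundPropagators, Thm 3.3 p.399] -/
theorem not_sockB9All_cubeMember (hd2 : 2 ≤ d) {L : ℕ} (hL : 1 ≤ L) {η : ℝ} (hη : 0 < η) (a : Site d) (M : ℕ) {ρ : ℕ}
    (hρ : L ≤ ρ) {k : ℕ} (hk : 1 ≤ k) {B₀ B₀β cP β : ℝ} (hB₀ : 0 < B₀) (hcP : 0 < cP) :
    ¬ (∀ m, m ≤ k → ∃ len : Site d → ℝ,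
        SockB9P3 (𝔸 := 𝔸) L B₀ B₀β cP β len η m (cubeFam false L a M ρ k) (cubeLamS L a M ρ k) (cubeLamB L a M ρ k)) := by
  intro H
  have hd1 : 1 ≤ d := le_trans (by norm_num) hd2
  have hK : 0 < min cP (cP / (2 * (L * (5 * (d : ℝ) * L * B₀)) + 8 * (8 * (0 : ℝ) * (5 * (d : ℝ) * L * B₀)))) := by
    have hL0 : (0 : ℝ) < L := by exact_mod_cast hL
    have hd0 : (0 : ℝ) < d := by exact_mod_cast (lt_of_lt_of_le (by norm_num) hd2)
    refine lt_min hcP (div_pos hcP ?_)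
    have h1 : 0 < 2 * (L * (5 * (d : ℝ) * L * B₀)) := by positivity
    simpa using h1
  exact not_sockH59_cubeMember hd2 hL hη a M hρ hk hB₀ le_rfl hK (sockH59_of_allLevels_len hd1 hL hB₀ le_rfl hcP H)


/-! ## §2 At the H lane's letters: `SB9AllL` and the common `hLeaf` of BASE-LEAF ∕ STEP-LEAF are uninhabitable -/

section HLane

open Literature.MathematicalPhysics.QuantumFieldTheory.Balaban1983to89.T3ContinuumYM3Torus
open B7Prop1Explicit renaming Site → LSite
open B7Eq78Linearization (zdBlocking QprimeIter)
open B8Eq119TwistedAxial (bgT)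
open B8Eq138LandauZd (covLap QT)
open B8Eq1117Concrete (XSpace)
open B8Prop5ContractionKLevel (Bd2)
open B8LambdaSpaceKLevel (wt)
open B8SpecialUnitaryTrace (trCLM)
open scoped Matrix.Norms.L2Operator

/-- ★★ **`SB9AllL` IS FALSE** (given any `T3Family` — the H lane's own index type): instantiate the ∀-level leaf socket at the member
`(F, n := 0, K := 1, a := 0, ρ′ := (F.P 1).L)` and apply `not_sockB9All_cubeMember` at `𝔸 := M₂(ℂ)`.
[cite: Balaban1985RegularSpaces, (1.58)–(1.59) p.86, (1.131) p.99, p.77; Balaban1985BackgroundPropagators, Thm 3.3 p.399] -/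
theorem sB9AllL_false (M' : ℕ) (F : T3Family) {B₀ B₀β cB9 β : ℝ} (hB₀ : 0 < B₀) (hcB9 : 0 < cB9)
    (hSB9All : ∀ (F : T3Family) (n K : ℕ), n < K → ∀ (a : LSite (F.P K).d) (ρ' : ℕ) (m : ℕ), m ≤ K - n → ∃ len : LSite (F.P K).d → ℝ,
          @SockB9P3 (F.P K).d (Matrix (Fin 2) (Fin 2) ℂ) (B10Eq29TubeLine.cstarAlgebraMatrix 2) (F.P K).L B₀ B₀β cB9 β len (((F.L : ℝ)⁻¹) ^ (K - n)) m
            (cubeFam false (F.P K).L a M' ρ' (K - n)) (cubeLamS (F.P K).L a M' ρ' (K - n)) (cubeLamB (F.P K).L a M' ρ' (K - n))) : False := by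
  letI : CStarAlgebra (Matrix (Fin 2) (Fin 2) ℂ) := B10Eq29TubeLine.cstarAlgebraMatrix 2
  have hd2 : 2 ≤ (F.P 1).d := by rw [T3Family.P_d F 1]; norm_num
  have hL2 : 2 ≤ (F.P 1).L := (F.P 1).hL.2
  have hL1 : 1 ≤ (F.P 1).L := le_trans (by norm_num) hL2
  have hη : 0 < ((F.L : ℝ)⁻¹) ^ (1 - 0) := by
    have hL0 : (0 : ℝ) < F.L := by exact_mod_cast (F.P 1).L_pos
    positivity
  exact not_sockB9All_cubeMember hd2 hL1 hη (0 : LSite (F.P 1).d) M' le_rfl (k := 1 - 0) le_rfl hB₀ hcB9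
    (hSB9All F 0 1 zero_lt_one (0 : LSite (F.P 1).d) ((F.P 1).L))

/-- ★★ **THE COMMON LEAF HYPOTHESIS `hLeaf` OF BASE-LEAF (✓p676580) ∕ STEP-LEAF ∕ K-final v3 IS UNINHABITABLE** (given any `T3Family`): at `L := 3`
its ∃-body carries `0 < B₀`, `0 < cB9` and `SB9AllL`, which `sB9AllL_false` refutes.  So BOARD v6 «H = SLetτAllL ∧ SB9AllL», as lettered, would be
VACUOUS — located typing defect (pub-ymgap's «(1.59) in the `SideTouches` currency at a finite `Ω₀`»), NOT a statement about print or the stub.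
[cite: Balaban1985RegularSpaces, (1.58)–(1.59) p.86, (1.131) p.99, p.77; Balaban1985BackgroundPropagators, Thm 3.3 p.399] -/
theorem hLeaf_false (M' : ℕ) (F : T3Family)
    (hLeaf : ∀ L : ℕ, Odd L → 1 < L → ∃ (B₀ B₀'H B₂' BG BR cB9 B₀β β : ℝ), 0 < B₀ ∧ 0 < B₀'H ∧ 0 ≤ B₂' ∧ 0 ≤ BG ∧ 0 ≤ BR ∧ 0 < cB9 ∧
        -- `SLetτAllL`: the [4] letters at `(U₀ := 1)` at EVERY truncation `1 ≤ n′ ≤ K − n` on every cube family of the member (geometry only; #46 (1) VERBATIM)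
        (∀ (F : T3Family) (n K : ℕ), n < K → ∀ (a : LSite (F.P K).d) (ρ' : ℕ) (n' : ℕ), 1 ≤ n' → n' ≤ K - n →
          ∃ (g Δ : (LSite (F.P K).d → Matrix (Fin 2) (Fin 2) ℂ) →ₗ[ℂ] (LSite (F.P K).d → Matrix (Fin 2) (Fin 2) ℂ))
            (q : (LSite (F.P K).d → Matrix (Fin 2) (Fin 2) ℂ) →ₗ[ℂ] (ℕ → LSite (F.P K).d → Matrix (Fin 2) (Fin 2) ℂ))
            (qs : (ℕ → LSite (F.P K).d → Matrix (Fin 2) (Fin 2) ℂ) →ₗ[ℂ] (LSite (F.P K).d → Matrix (Fin 2) (Fin 2) ℂ))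
            (Aw c : (ℕ → LSite (F.P K).d → Matrix (Fin 2) (Fin 2) ℂ) →ₗ[ℂ] (ℕ → LSite (F.P K).d → Matrix (Fin 2) (Fin 2) ℂ))
            (H' : XSpace (F.P K).d n' (Matrix (Fin 2) (Fin 2) ℂ) →ₗ[ℂ] (LSite (F.P K).d → Matrix (Fin 2) (Fin 2) ℂ)),
          (∀ x, ∀ y ∈ cubeFam false (F.P K).L a M' ρ' (K - n) 0, (Δ (g x) + qs (Aw (q (g x)))) y = x y) ∧ (∀ f, q (g (g (qs (c (q f))))) = q f) ∧
          (∀ (f : LSite (F.P K).d → Matrix (Fin 2) (Fin 2) ℂ), ∀ x ∈ cubeFam false (F.P K).L a M' ρ' (K - n) 0,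
            Δ f x = covLap (((F.L : ℝ)⁻¹) ^ (K - n)) (1 : LSite (F.P K).d → Fin (F.P K).d → (Matrix (Fin 2) (Fin 2) ℂ)ˣ) ((cubeFam false (F.P K).L a M' ρ' (K - n) 0).indicator f) x) ∧
          (∀ (μ : ℕ → LSite (F.P K).d → Matrix (Fin 2) (Fin 2) ℂ), ∀ x ∈ cubeFam false (F.P K).L a M' ρ' (K - n) 0,
            qs μ x = QT (F.P K).L n' (cubeLamS (F.P K).L a M' ρ' (K - n) n') (1 : LSite (F.P K).d → Fin (F.P K).d → (Matrix (Fin 2) (Fin 2) ℂ)ˣ) μ x) ∧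
          (∀ (f : LSite (F.P K).d → Matrix (Fin 2) (Fin 2) ℂ) (j : ℕ), j ≤ n' → ∀ y ∈ cubeLamS (F.P K).L a M' ρ' (K - n) n' j,
            q f j y = QprimeIter (zdBlocking (F.P K).d (F.P K).L) (bgT (F.P K).L (1 : LSite (F.P K).d → Fin (F.P K).d → (Matrix (Fin 2) (Fin 2) ℂ)ˣ)) j f y) ∧
          (∀ (X : XSpace (F.P K).d n' (Matrix (Fin 2) (Fin 2) ℂ)) (x : LSite (F.P K).d), ‖H' X x‖ ≤ B₀'H * ‖X‖) ∧
          (∀ j, j ≤ n' → ∀ (X : XSpace (F.P K).d n' (Matrix (Fin 2) (Fin 2) ℂ)), ∀ p ∈ {b : LSite (F.P K).d × Fin (F.P K).d | SideTouches (cubeFam false (F.P K).L a M' ρ' (K - n) j) b.1 b.2},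
            wt (F.P K).L (((F.L : ℝ)⁻¹) ^ (K - n)) j * ‖covDerivFwd (((F.L : ℝ)⁻¹) ^ (K - n)) (1 : LSite (F.P K).d → Fin (F.P K).d → (Matrix (Fin 2) (Fin 2) ℂ)ˣ) p.2 (H' X) p.1‖ ≤ B₀'H * ‖X‖) ∧
          (∀ X : XSpace (F.P K).d n' (Matrix (Fin 2) (Fin 2) ℂ), Bd2 (F.P K).L (((F.L : ℝ)⁻¹) ^ (K - n)) n' (cubeFam false (F.P K).L a M' ρ' (K - n))
            (covLap (((F.L : ℝ)⁻¹) ^ (K - n)) (1 : LSite (F.P K).d → Fin (F.P K).d → (Matrix (Fin 2) (Fin 2) ℂ)ˣ) (H' X)) (B₂' * ‖X‖)) ∧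
          (∀ (X : XSpace (F.P K).d n' (Matrix (Fin 2) (Fin 2) ℂ)) (x : LSite (F.P K).d), x ∉ cubeFam false (F.P K).L a M' ρ' (K - n) 0 → H' X x = 0) ∧
          (∀ X Y : XSpace (F.P K).d n' (Matrix (Fin 2) (Fin 2) ℂ), (∀ p, Y p = -star (X p)) → ∀ x, H' Y x = -star (H' X x)) ∧
          (∀ (Y : XSpace (F.P K).d n' (Matrix (Fin 2) (Fin 2) ℂ)) (j : ℕ) (hj : j ≤ n') (y : LSite (F.P K).d), y ∈ cubeLamS (F.P K).L a M' ρ' (K - n) n' j →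
            QprimeIter (zdBlocking (F.P K).d (F.P K).L) (bgT (F.P K).L (1 : LSite (F.P K).d → Fin (F.P K).d → (Matrix (Fin 2) (Fin 2) ℂ)ˣ)) j (H' Y) y = Y (⟨j, Nat.lt_succ_of_le hj⟩, y)) ∧
          (∀ (f : LSite (F.P K).d → Matrix (Fin 2) (Fin 2) ℂ) (r : ℝ), 0 ≤ r → Bd2 (F.P K).L (((F.L : ℝ)⁻¹) ^ (K - n)) n' (cubeFam false (F.P K).L a M' ρ' (K - n)) f r →
            (∀ x, ‖g f x‖ ≤ BG * r) ∧ ∀ j, j ≤ n' → ∀ p ∈ {b : LSite (F.P K).d × Fin (F.P K).d | SideTouches (cubeFam false (F.P K).L a M' ρ' (K - n) j) b.1 b.2},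
              wt (F.P K).L (((F.L : ℝ)⁻¹) ^ (K - n)) j * ‖covDerivFwd (((F.L : ℝ)⁻¹) ^ (K - n)) (1 : LSite (F.P K).d → Fin (F.P K).d → (Matrix (Fin 2) (Fin 2) ℂ)ˣ) p.2 (g f) p.1‖ ≤ BG * r) ∧
          (∀ (f : LSite (F.P K).d → Matrix (Fin 2) (Fin 2) ℂ) (x : LSite (F.P K).d), x ∉ cubeFam false (F.P K).L a M' ρ' (K - n) 0 → g f x = 0) ∧
          (∀ f : LSite (F.P K).d → Matrix (Fin 2) (Fin 2) ℂ, (∀ j, j ≤ n' → ∀ x ∈ cubeFam false (F.P K).L a M' ρ' (K - n) j, IsSelfAdjoint (f x)) → ∀ x, IsSelfAdjoint (g f x)) ∧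
          (∀ (f : LSite (F.P K).d → Matrix (Fin 2) (Fin 2) ℂ) (r : ℝ), 0 ≤ r → Bd2 (F.P K).L (((F.L : ℝ)⁻¹) ^ (K - n)) n' (cubeFam false (F.P K).L a M' ρ' (K - n)) f r →
            Bd2 (F.P K).L (((F.L : ℝ)⁻¹) ^ (K - n)) n' (cubeFam false (F.P K).L a M' ρ' (K - n)) (f - g (qs (c (q (g f))))) (BR * r)) ∧
          (∀ f : LSite (F.P K).d → Matrix (Fin 2) (Fin 2) ℂ, (∀ j, j ≤ n' → ∀ x ∈ cubeFam false (F.P K).L a M' ρ' (K - n) j, IsSelfAdjoint (f x)) →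
            ∀ j, j ≤ n' → ∀ x ∈ cubeFam false (F.P K).L a M' ρ' (K - n) j, IsSelfAdjoint ((f - g (qs (c (q (g f))))) x)) ∧
          (∀ X : XSpace (F.P K).d n' (Matrix (Fin 2) (Fin 2) ℂ), (∀ p, trCLM (Fin 2) (X p) = 0) → ∀ x, trCLM (Fin 2) (H' X x) = 0) ∧
          (∀ f : LSite (F.P K).d → Matrix (Fin 2) (Fin 2) ℂ, (∀ j, j ≤ n' → ∀ x ∈ cubeFam false (F.P K).L a M' ρ' (K - n) j, trCLM (Fin 2) (f x) = 0) → ∀ x, trCLM (Fin 2) (g f x) = 0) ∧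
          (∀ f : LSite (F.P K).d → Matrix (Fin 2) (Fin 2) ℂ, (∀ j, j ≤ n' → ∀ x ∈ cubeFam false (F.P K).L a M' ρ' (K - n) j, trCLM (Fin 2) (f x) = 0) →
            ∀ j, j ≤ n' → ∀ x ∈ cubeFam false (F.P K).L a M' ρ' (K - n) j, trCLM (Fin 2) ((f - g (qs (c (q (g f))))) x) = 0)) ∧
        -- `SB9AllL`: the ∀-level (1.59)-family socket in print's shape (WORD 10 SHAPE RULING; #46 (2) VERBATIM, ∀-closed over the geometry)
        (∀ (F : T3Family) (n K : ℕ), n < K → ∀ (a : LSite (F.P K).d) (ρ' : ℕ) (m : ℕ), m ≤ K - n → ∃ len : LSite (F.P K).d → ℝ,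
          @SockB9P3 (F.P K).d (Matrix (Fin 2) (Fin 2) ℂ) (B10Eq29TubeLine.cstarAlgebraMatrix 2) (F.P K).L B₀ B₀β cB9 β len (((F.L : ℝ)⁻¹) ^ (K - n)) m
            (cubeFam false (F.P K).L a M' ρ' (K - n)) (cubeLamS (F.P K).L a M' ρ' (K - n)) (cubeLamB (F.P K).L a M' ρ' (K - n)))) : False := by
  obtain ⟨B₀, B₀'H, B₂', BG, BR, cB9, B₀β, β, hB₀, -, -, -, -, hcB9, -, hSB9All⟩ := hLeaf 3 ⟨1, rfl⟩ (by norm_num)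
  exact sB9AllL_false M' F hB₀ hcB9 hSB9All

end HLane

end Summit.QuantumFields.YangMills.Theorems.HalvingHSB9AllNotAtCubeMember

end
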